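import Summits.QuantumFields.YangMills.Theorems.LuscherReductionTwistedTraceScalingBODefectSplit
import HarnessLib

/-!
# (C4-CORE γ, algebra) AN ABSOLUTE PIECE BECOMES A RATE AGAINST THE CURRENCY FLOOR
# (lane A of S-BASE, crux `TwistedTraceScaling` stmt-QuantumFields-20203, C4-CORE, the (OD) pen; `pub/ym-fleet/ym-luscher-20007-p1/HANDOFF-g20.md` (γ))

★ `piece_le_rate` — if `Fl·‖φ‖² ≤ Λ²·T` (the currency floor `…BOCurrencyFloor(Z).currency_floor(_inv)`, `Fl > 0`) and a piece satisfies `I₂ ≤ X·‖φ‖²` (`X ≥ 0`), then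
`I₂ ≤ (√(X/Fl)·Λ)²·T`, i.e. the piece carries the RATE `b₂ = √(X/Fl)` with `b₂² = X/Fl` (`sq_sqrt_rate`) — the input shape of `…BODefectSplit.defect_bound_of_pieces` and of
`…BODefectPieceRates.piece_rate_small`.
HONEST FRAMING: bookkeeping for a stub of a child of the CONDITIONAL route R2b1; the hOD assembly, (B-ST), C4-CORE remain OPEN; not a gap, not Clay.
-/

set_option autoImplicit false

noncomputable section

namespace Summit.QuantumFields.YangMills.Theorems.FemtoTransferGap.TwoLattice.ConstTube

/-- `(√(X/Fl))² = X/Fl` for `X ≥ 0`, `Fl > 0`. [folklore] -/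
theorem sq_sqrt_rate {X Fl : ℝ} (hX : 0 ≤ X) (hFl : 0 < Fl) : Real.sqrt (X / Fl) ^ 2 = X / Fl := Real.sq_sqrt (div_nonneg hX hFl.le)

/-- ★ **AN ABSOLUTE PIECE IS A RATE AGAINST THE FLOOR**: `Fl·I ≤ Λ²T`, `I₂ ≤ X·I`, `Fl > 0`, `X ≥ 0` ⇒ `I₂ ≤ (√(X/Fl)·Λ)²·T`. [folklore] -/
theorem piece_le_rate {I₂ X I Fl Λ T : ℝ} (hFl : 0 < Fl) (hX : 0 ≤ X) (hfloor : Fl * I ≤ Λ ^ 2 * T) (h : I₂ ≤ X * I) :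
    I₂ ≤ (Real.sqrt (X / Fl) * Λ) ^ 2 * T := by
  rw [mul_pow, sq_sqrt_rate hX hFl]
  have h1 : X * I = X / Fl * (Fl * I) := by field_simp
  have h2 : X / Fl * (Fl * I) ≤ X / Fl * (Λ ^ 2 * T) := mul_le_mul_of_nonneg_left hfloor (div_nonneg hX hFl.le)
  calc I₂ ≤ X * I := h
    _ = X / Fl * (Fl * I) := h1
    _ ≤ X / Fl * (Λ ^ 2 * T) := h2
    _ = X / Fl * Λ ^ 2 * T := by ring

/-- The same for a piece whose absolute bound carries an extra factor `Zq ≥ 0` also present in the floor (`Fl·Zq·I ≤ Λ²T`, e.g. `Zq = fpZ^{-2}`):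
`I₂ ≤ X·Zq·I` ⇒ `I₂ ≤ (√(X/Fl)·Λ)²·T`. [folklore] -/
theorem piece_le_rate_of_factor {I₂ X I Fl Zq Λ T : ℝ} (hFl : 0 < Fl) (hX : 0 ≤ X) (hfloor : Fl * Zq * I ≤ Λ ^ 2 * T) (h : I₂ ≤ X * Zq * I) :
    I₂ ≤ (Real.sqrt (X / Fl) * Λ) ^ 2 * T := by
  rw [mul_pow, sq_sqrt_rate hX hFl]
  have h1 : X * Zq * I = X / Fl * (Fl * Zq * I) := by field_simp
  have h2 : X / Fl * (Fl * Zq * I) ≤ X / Fl * (Λ ^ 2 * T) := mul_le_mul_of_nonneg_left hfloor (div_nonneg hX hFl.le)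
  calc I₂ ≤ X * Zq * I := h
    _ = X / Fl * (Fl * Zq * I) := h1
    _ ≤ X / Fl * (Λ ^ 2 * T) := h2
    _ = X / Fl * Λ ^ 2 * T := by ring

/-- A RELATIVE piece (`I₁ ≤ (b₁·Λ')²·T` with `Λ' = Λ` up to rewriting, e.g. `btC·Z⁻¹/γ·λ` versus `btC/Z/γ·λ`) is already a rate. [folklore] -/
theorem sigma_forms_eq (btC Z γ lam : ℝ) : btC * Z⁻¹ / γ * lam = btC / Z / γ * lam := by rw [div_eq_mul_inv btC Z]

end Summit.QuantumFields.YangMills.Theorems.FemtoTransferGap.TwoLattice.ConstTube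

end
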